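import Literature.Probability.Percolation.SharpnessDCTProofs
import HarnessLib

/-!
# Cluster bookkeeping for the isolation surgery on `ℤ²×ℤ`
(`stub_locModScheme` of line `locmod`, crux `CriticalCurveRegular`, stmt-CriticalPhenomena-16065 — part 1)

For a bond configuration `ω` on `Λ_n = box 3 n ⊂ ℤ³`, a "window" `Q` (a finite set of sites) and the
set `W = edgesTouching (zdGraph 3) Q` of lattice bonds meeting `Q`, we record the elementary facts
used by the isolation surgery of the crux idea `isolation-descent`:

* paths avoiding `Q` are paths of `ω ∖ W`, and paths of `ω ∖ W` from a site outside `Q` avoid `Q`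
  (`pathIn_sdiff_of_avoid`, `notMem_of_pathIn_sdiff`), while from a site of `Q` they do not move
  at all (`eq_of_pathIn_sdiff_of_mem`);
* for a vertical bond `e = {x, x+e₃}` pivotal for the one-arm event `{0 ↔ ∂Λ_n}` in `S`, one
  endpoint of `e` lies in the `0`-cluster `C` of `ω' = S ∖ e` and the other is joined to `∂Λ_n`
  in `ω'` (`exists_endpoints`);
* ENTRY data (`exists_entry`): a site `a ∈ Q` and at most one bond `g_a ∈ ω'` such that `0 → a`
  is open in `(ω' ∖ W) ∪ {g_a}`, `a ∈ C`, and every site of the `0`-cluster of `ω' ∖ W` lying in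
  `Q` equals `a` (if `0 ∈ Q` then `a = 0` and no bond is kept; otherwise `a` is the first entry
  into `Q` of an open path `0 → C ∩ Q`);
* EXIT data (`exists_exit`): a site `b ∈ Q` and at most one bond `g_b ∈ ω'` such that `b → ∂Λ_n`
  is open in `(ω' ∖ W) ∪ {g_b}` and the endpoints of `g_b` are joined to `∂Λ_n` in `ω'`.

References: Grimmett, *Percolation* (1999), §3.3, proof of (3.12) (local modification);
Aizenman–Grimmett, J. Stat. Phys. 63 (1991); idea card `Cruxes/CriticalCurveRegular/Ideas/isolation-descent.md`.
-/

noncomputable section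

open Set
open Literature.Probability.Percolation Literature.Probability.LatticeModels

namespace Summit.CriticalPhenomena.PercolationContinuityZ3.Cruxes.CriticalCurveRegular.Locmod

namespace Clusters

/-! ## Paths and the window -/

/-- A bond of `ℤ³` with no endpoint in `Q` is not a bond touching `Q`. -/
theorem mk_notMem_edgesTouching {Q : Finset (Site 3)} {y y' : Site 3} (hy : y ∉ Q) (hy' : y' ∉ Q) :
    s(y, y') ∉ edgesTouching (zdGraph 3) Q := by
  intro h
  rw [mem_edgesTouching_iff] at h
  obtain ⟨-, z, hz, hzm⟩ := h
  rcases Sym2.mem_iff.1 hzm with rfl | rfl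
  · exact hy hz
  · exact hy' hz

/-- A lattice bond with an endpoint in `Q` touches `Q`. -/
theorem mk_mem_edgesTouching {Q : Finset (Site 3)} {y y' : Site 3}
    (he : s(y, y') ∈ (zdGraph 3).edgeSet) (hy : y ∈ Q) : s(y, y') ∈ edgesTouching (zdGraph 3) Q := by
  rw [mem_edgesTouching_iff]
  exact ⟨he, y, hy, Sym2.mem_mk_left y y'⟩

/-- **Paths avoiding the window are paths of `ω ∖ W`.** An open path all of whose sites lie
outside `Q` uses no bond touching `Q`. -/
theorem pathIn_sdiff_of_avoid {ω : Set (Sym2 (Site 3))} {Q : Finset (Site 3)} {Λ : Set (Site 3)}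
    {u v : Site 3} (h : PathIn (openGraph ω) ((↑Q)ᶜ ∩ Λ) u v) :
    PathIn (openGraph (ω \ ↑(edgesTouching (zdGraph 3) Q))) Λ u v := by
  refine (DCT16.pathIn_congrGraph (G' := openGraph (ω \ ↑(edgesTouching (zdGraph 3) Q)))
    (fun a b ha hb hab => ?_) h).mono Set.inter_subset_right
  rw [openGraph_adj] at hab ⊢
  exact ⟨⟨hab.1, mk_notMem_edgesTouching ha.1 hb.1⟩, hab.2⟩

/-- **Paths of `ω ∖ W` from outside `Q` avoid `Q`** (for `ω ⊆ E(ℤ³)`): every bond they use is a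
lattice bond not touching `Q`, so no step enters `Q`. -/
theorem notMem_of_pathIn_sdiff {ω : Set (Sym2 (Site 3))} (hω : ω ⊆ (zdGraph 3).edgeSet)
    {Q : Finset (Site 3)} {Λ : Set (Site 3)} {u v : Site 3}
    (h : PathIn (openGraph (ω \ ↑(edgesTouching (zdGraph 3) Q))) Λ u v) (hu : u ∉ Q) : v ∉ Q := by
  refine DCT16.pathIn_induction (fun w => w ∉ Q) h hu fun a b _ _ ha hab hb => ?_
  rw [openGraph_adj] at hab
  obtain ⟨⟨habω, habW⟩, -⟩ := hab
  refine habW ?_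
  rw [Sym2.eq_swap]
  exact mk_mem_edgesTouching (by rw [Sym2.eq_swap]; exact hω habω) hb

/-- **From a site of `Q`, paths of `ω ∖ W` do not move** (for `ω ⊆ E(ℤ³)`): the first bond
would touch `Q`. -/
theorem eq_of_pathIn_sdiff_of_mem {ω : Set (Sym2 (Site 3))} (hω : ω ⊆ (zdGraph 3).edgeSet)
    {Q : Finset (Site 3)} {Λ : Set (Site 3)} {u v : Site 3}
    (h : PathIn (openGraph (ω \ ↑(edgesTouching (zdGraph 3) Q))) Λ u v) (hu : u ∈ Q) : v = u := by
  refine DCT16.pathIn_induction (fun w => w = u) h rfl fun a b _ _ ha hab => ?_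
  subst ha
  rw [openGraph_adj] at hab
  obtain ⟨⟨habω, habW⟩, -⟩ := hab
  exact absurd (mk_mem_edgesTouching (hω habω) hu) habW

/-- Paths of a smaller configuration are paths of a larger one. -/
theorem pathIn_mono_config {ω ω' : Set (Sym2 (Site 3))} (hle : ω ⊆ ω') {Λ : Set (Site 3)}
    {u v : Site 3} (h : PathIn (openGraph ω) Λ u v) : PathIn (openGraph ω') Λ u v :=
  h.mono_graph fun a b hab => by
    rw [openGraph_adj] at hab ⊢
    exact ⟨hle hab.1, hab.2⟩

/-! ## The two endpoints of a pivotal bond -/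

/-- **Forward cluster tracking.** Along an open path of `insert e ω'` from `0`, if no endpoint of
`e = {x₁, x₂}` lies in the `0`-cluster of `ω'`, then the whole path lies in that cluster. -/
theorem pathIn_of_pathIn_insert {ω' : Set (Sym2 (Site 3))} {Λ : Set (Site 3)} {x₁ x₂ v : Site 3}
    (h : PathIn (openGraph (insert s(x₁, x₂) ω')) Λ 0 v)
    (h₁ : ¬ PathIn (openGraph ω') Λ 0 x₁) (h₂ : ¬ PathIn (openGraph ω') Λ 0 x₂) :
    PathIn (openGraph ω') Λ 0 v := by
  refine DCT16.pathIn_induction (fun w => PathIn (openGraph ω') Λ 0 w) h (PathIn.refl h.left_mem)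
    fun a b _ hb ha hab => ?_
  rw [openGraph_adj] at hab
  obtain ⟨hmem, hne⟩ := hab
  rcases Set.mem_insert_iff.1 hmem with heq | hω
  · -- the step is `e` itself: then `a` is an endpoint of `e`, contradiction
    exfalso
    have ha' : a ∈ s(x₁, x₂) := by rw [← heq]; exact Sym2.mem_mk_left a b
    rcases Sym2.mem_iff.1 ha' with rfl | rfl
    · exact h₁ ha
    · exact h₂ ha
  · exact ha.tail ((openGraph_adj ω' a b).2 ⟨hω, hne⟩) hb

/-- **Backward cluster tracking.** Along an open path of `insert e ω'` ending on a target set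
`Z`, if no endpoint of `e` is joined to `Z` in `ω'`, then the start is joined to `Z` in `ω'`. -/
theorem joined_of_pathIn_insert {ω' : Set (Sym2 (Site 3))} {Λ : Set (Site 3)} {Z : Set (Site 3)}
    {x₁ x₂ u z : Site 3} (h : PathIn (openGraph (insert s(x₁, x₂) ω')) Λ u z) (hz : z ∈ Z)
    (h₁ : ¬ ∃ z' ∈ Z, PathIn (openGraph ω') Λ x₁ z') (h₂ : ¬ ∃ z' ∈ Z, PathIn (openGraph ω') Λ x₂ z') :
    ∃ z' ∈ Z, PathIn (openGraph ω') Λ u z' := by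
  -- reverse the path and track the property "joined to `Z` in `ω'`" from `z` backwards
  have h' := h.symm
  refine DCT16.pathIn_induction (fun w => ∃ z' ∈ Z, PathIn (openGraph ω') Λ w z') h'
    ⟨z, hz, PathIn.refl h.right_mem⟩ fun a b ha hb hP hab => ?_
  rw [openGraph_adj] at hab
  obtain ⟨hmem, hne⟩ := hab
  rcases Set.mem_insert_iff.1 hmem with heq | hω
  · exfalso
    have ha' : a ∈ s(x₁, x₂) := by rw [← heq]; exact Sym2.mem_mk_left a b
    rcases Sym2.mem_iff.1 ha' with rfl | rfl
    · exact h₁ hP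
    · exact h₂ hP
  · obtain ⟨z', hz', hp⟩ := hP
    refine ⟨z', hz', ?_⟩
    have hba : (openGraph ω').Adj b a := ((openGraph_adj ω' a b).2 ⟨hω, hne⟩).symm
    exact (PathIn.of_adj hb ha hba).trans hp

/-- **The two endpoints of a pivotal bond.** If `e = {x₁, x₂}` is pivotal for `{0 ↔ ∂Λ_n}` in the
sense that `insert e ω' ∈ A` and `ω' ∉ A`, then (after possibly swapping) `x₁` lies in the
`0`-cluster of `ω'` inside `Λ_n` and `x₂` is joined to `∂Λ_n` in `ω'` inside `Λ_n`. -/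
theorem exists_endpoints {n : ℕ} {ω' : Set (Sym2 (Site 3))} {x₁ x₂ : Site 3}
    (hin : insert s(x₁, x₂) ω' ∈ siteToBoundary 3 n) (hout : ω' ∉ siteToBoundary 3 n) :
    ∃ y₁ y₂ : Site 3, s(y₁, y₂) = s(x₁, x₂) ∧
      PathIn (openGraph ω') ↑(box 3 n) 0 y₁ ∧
      ∃ z ∈ innerBoundary (zdGraph 3) (box 3 n), PathIn (openGraph ω') ↑(box 3 n) y₂ z := by
  rw [DCT16.mem_siteToBoundary_iff] at hin hout
  obtain ⟨z, hz, hpath⟩ := hin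
  push Not at hout
  -- some endpoint is in the `0`-cluster
  have hC : PathIn (openGraph ω') ↑(box 3 n) 0 x₁ ∨ PathIn (openGraph ω') ↑(box 3 n) 0 x₂ := by
    by_contra hcon
    push Not at hcon
    exact hout z hz (pathIn_of_pathIn_insert hpath hcon.1 hcon.2)
  -- some endpoint is joined to the boundary
  have hD : (∃ z' ∈ (↑(innerBoundary (zdGraph 3) (box 3 n)) : Set (Site 3)),
      PathIn (openGraph ω') ↑(box 3 n) x₁ z') ∨
      ∃ z' ∈ (↑(innerBoundary (zdGraph 3) (box 3 n)) : Set (Site 3)),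
        PathIn (openGraph ω') ↑(box 3 n) x₂ z' := by
    by_contra hcon
    push Not at hcon
    have hcon1 : ¬ ∃ z' ∈ (↑(innerBoundary (zdGraph 3) (box 3 n)) : Set (Site 3)),
        PathIn (openGraph ω') ↑(box 3 n) x₁ z' := fun ⟨z', hz', hp⟩ => hcon.1 z' hz' hp
    have hcon2 : ¬ ∃ z' ∈ (↑(innerBoundary (zdGraph 3) (box 3 n)) : Set (Site 3)),
        PathIn (openGraph ω') ↑(box 3 n) x₂ z' := fun ⟨z', hz', hp⟩ => hcon.2 z' hz' hp
    obtain ⟨z', hz', hp⟩ := joined_of_pathIn_insert hpath (Finset.mem_coe.2 hz) hcon1 hcon2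
    exact hout z' hz' hp
  -- the same endpoint cannot do both
  have key : ∀ y, PathIn (openGraph ω') ↑(box 3 n) 0 y →
      ¬ ∃ z' ∈ (↑(innerBoundary (zdGraph 3) (box 3 n)) : Set (Site 3)),
        PathIn (openGraph ω') ↑(box 3 n) y z' := by
    rintro y hy ⟨z', hz', hp⟩
    exact hout z' hz' (hy.trans hp)
  rcases hC with h1 | h2
  · rcases hD with hD | ⟨z', hz', hp⟩
    · exact absurd hD (key x₁ h1)
    · exact ⟨x₁, x₂, rfl, h1, z', hz', hp⟩
  · rcases hD with ⟨z', hz', hp⟩ | hD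
    · exact ⟨x₂, x₁, Sym2.eq_swap, h2, z', hz', hp⟩
    · exact absurd hD (key x₂ h2)

/-! ## Entry and exit data -/

/-- **Entry data.** Let `ω' ⊆ E(ℤ³)` with `ω' ∉ {0 ↔ ∂Λ_n}`, `Q` a window and `x₁ ∈ Q` a site
of the `0`-cluster of `ω'`. Then there are a site `a ∈ Q ∩ Λ_n` and a set `Ga` of at most one bond
of `ω'` touching `Q` such that: `0 → a` is open in `(ω' ∖ W) ∪ Ga` inside `Λ_n`; `a` lies in the
`0`-cluster of `ω'`; every endpoint of a bond of `Ga` lies in the `0`-cluster of `ω' ∖ W` or equals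
`a`; and every site of the `0`-cluster of `ω' ∖ W` lying in `Q` equals `a`. -/
theorem exists_entry {n : ℕ} {ω' : Set (Sym2 (Site 3))} (hω : ω' ⊆ (zdGraph 3).edgeSet)
    {Q : Finset (Site 3)} {x₁ : Site 3} (hx₁ : x₁ ∈ Q)
    (hC : PathIn (openGraph ω') ↑(box 3 n) 0 x₁) :
    ∃ (a : Site 3) (Ga : Finset (Sym2 (Site 3))),
      a ∈ Q ∧ a ∈ box 3 n ∧ (↑Ga : Set (Sym2 (Site 3))) ⊆ ω' ∧ Ga ⊆ edgesTouching (zdGraph 3) Q ∧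
      PathIn (openGraph ω') ↑(box 3 n) 0 a ∧
      PathIn (openGraph ((ω' \ ↑(edgesTouching (zdGraph 3) Q)) ∪ ↑Ga)) ↑(box 3 n) 0 a ∧
      (∀ g ∈ Ga, ∀ y ∈ g,
        PathIn (openGraph (ω' \ ↑(edgesTouching (zdGraph 3) Q))) ↑(box 3 n) 0 y ∨ y = a) ∧
      (∀ y, PathIn (openGraph (ω' \ ↑(edgesTouching (zdGraph 3) Q))) ↑(box 3 n) 0 y → y ∈ Q → y = a) := by
  have h0 : (0 : Site 3) ∈ (↑(box 3 n) : Set (Site 3)) := hC.left_mem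
  by_cases hQ : (0 : Site 3) ∈ Q
  · -- `0 ∈ Q`: keep nothing, `a = 0`
    refine ⟨0, ∅, hQ, h0, by simp, Finset.empty_subset _, PathIn.refl h0, ?_, by simp, ?_⟩
    · exact PathIn.refl h0
    · intro y hy _
      exact eq_of_pathIn_sdiff_of_mem hω hy hQ
  · -- `0 ∉ Q`: first entry of the path `0 → x₁` into `Q`
    obtain ⟨a', a, ha', ha, haΛ, hadj, hpre⟩ :=
      hC.exit (R := (↑Q : Set (Site 3))ᶜ) (by simpa using hQ) (by simpa using hx₁)
    have haQ : a ∈ Q := by simpa using ha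
    have ha'Q : a' ∉ Q := ha'
    rw [openGraph_adj] at hadj
    obtain ⟨hmem, hne⟩ := hadj
    have hpre' : PathIn (openGraph (ω' \ ↑(edgesTouching (zdGraph 3) Q))) ↑(box 3 n) 0 a' :=
      pathIn_sdiff_of_avoid hpre
    have htouch : s(a', a) ∈ edgesTouching (zdGraph 3) Q := by
      rw [Sym2.eq_swap]; exact mk_mem_edgesTouching (by rw [Sym2.eq_swap]; exact hω hmem) haQ
    refine ⟨a, {s(a', a)}, haQ, haΛ, by simpa using hmem, by simpa using htouch, ?_, ?_, ?_, ?_⟩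
    · exact (hpre.mono Set.inter_subset_right).tail ((openGraph_adj ω' a' a).2 ⟨hmem, hne⟩) haΛ
    · refine (pathIn_mono_config Set.subset_union_left hpre').tail ?_ haΛ
      rw [openGraph_adj]
      exact ⟨Or.inr (by simp), hne⟩
    · intro g hg y hy
      rw [Finset.mem_singleton] at hg
      subst hg
      rcases Sym2.mem_iff.1 hy with rfl | rfl
      · exact Or.inl hpre'
      · exact Or.inr rfl
    · intro y hy hyQ
      exact absurd hyQ (notMem_of_pathIn_sdiff hω hy hQ)

/-- **Exit data.** Let `ω' ⊆ E(ℤ³)`, `Q` a window and `x₂ ∈ Q` a site joined to `∂Λ_n` in `ω'`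
inside `Λ_n`. Then there are a site `b ∈ Q ∩ Λ_n` and a set `Gb` of at most one bond of `ω'`
touching `Q` such that `b` is joined to `∂Λ_n` in `(ω' ∖ W) ∪ Gb` inside `Λ_n`, and every
endpoint of a bond of `Gb`, as well as `b` itself, is joined to `∂Λ_n` in `ω'` inside `Λ_n`. -/
theorem exists_exit {n : ℕ} {ω' : Set (Sym2 (Site 3))} (hω : ω' ⊆ (zdGraph 3).edgeSet)
    {Q : Finset (Site 3)} {x₂ : Site 3} (hx₂ : x₂ ∈ Q)
    (hD : ∃ z ∈ innerBoundary (zdGraph 3) (box 3 n), PathIn (openGraph ω') ↑(box 3 n) x₂ z) :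
    ∃ (b : Site 3) (Gb : Finset (Sym2 (Site 3))),
      b ∈ Q ∧ b ∈ box 3 n ∧ (↑Gb : Set (Sym2 (Site 3))) ⊆ ω' ∧ Gb ⊆ edgesTouching (zdGraph 3) Q ∧
      (∃ z ∈ innerBoundary (zdGraph 3) (box 3 n), PathIn (openGraph ω') ↑(box 3 n) b z) ∧
      (∃ z ∈ innerBoundary (zdGraph 3) (box 3 n),
        PathIn (openGraph ((ω' \ ↑(edgesTouching (zdGraph 3) Q)) ∪ ↑Gb)) ↑(box 3 n) b z) ∧
      (∀ g ∈ Gb, ∀ y ∈ g,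
        ∃ z ∈ innerBoundary (zdGraph 3) (box 3 n), PathIn (openGraph ω') ↑(box 3 n) y z) := by
  obtain ⟨z, hz, hpath⟩ := hD
  by_cases hB : ∃ b ∈ Q, b ∈ innerBoundary (zdGraph 3) (box 3 n)
  · -- the window meets the boundary: `b` on the boundary, keep nothing
    obtain ⟨b, hbQ, hb⟩ := hB
    have hbΛ : b ∈ box 3 n := (mem_innerBoundary_iff.1 hb).1
    refine ⟨b, ∅, hbQ, hbΛ, by simp, Finset.empty_subset _, ⟨b, hb, PathIn.refl hbΛ⟩,
      ⟨b, hb, PathIn.refl hbΛ⟩, by simp⟩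
  · -- otherwise `z ∉ Q`: last exit from `Q` = first entry of the reversed path
    push Not at hB
    have hzQ : z ∉ Q := fun h => hB z h hz
    obtain ⟨b', b, hb', hb, hbΛ, hadj, hpre⟩ :=
      hpath.symm.exit (R := (↑Q : Set (Site 3))ᶜ) (by simpa using hzQ) (by simpa using hx₂)
    have hbQ : b ∈ Q := by simpa using hb
    rw [openGraph_adj] at hadj
    obtain ⟨hmem, hne⟩ := hadj
    have hpre' : PathIn (openGraph (ω' \ ↑(edgesTouching (zdGraph 3) Q))) ↑(box 3 n) z b' :=
      pathIn_sdiff_of_avoid hpre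
    have hb'z : PathIn (openGraph ω') ↑(box 3 n) b' z := (hpre.mono Set.inter_subset_right).symm
    have hbadj : (openGraph ω').Adj b b' := ((openGraph_adj ω' b' b).2 ⟨hmem, hne⟩).symm
    have htouch : s(b', b) ∈ edgesTouching (zdGraph 3) Q := by
      rw [Sym2.eq_swap]; exact mk_mem_edgesTouching (by rw [Sym2.eq_swap]; exact hω hmem) hbQ
    refine ⟨b, {s(b', b)}, hbQ, hbΛ, by simpa using hmem, by simpa using htouch, ?_, ?_, ?_⟩
    · exact ⟨z, hz, (PathIn.of_adj hbΛ hb'z.left_mem hbadj).trans hb'z⟩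
    · refine ⟨z, hz, ?_⟩
      have hstep : (openGraph ((ω' \ ↑(edgesTouching (zdGraph 3) Q)) ∪ ↑({s(b', b)} :
          Finset (Sym2 (Site 3))))).Adj b b' := by
        rw [openGraph_adj, Sym2.eq_swap]
        exact ⟨Or.inr (by simp), hne.symm⟩
      exact (PathIn.of_adj hbΛ hpre'.right_mem hstep).trans
        (pathIn_mono_config Set.subset_union_left hpre').symm
    · intro g hg y hy
      rw [Finset.mem_singleton] at hg
      subst hg
      rcases Sym2.mem_iff.1 hy with rfl | rfl
      · exact ⟨z, hz, hb'z⟩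
      · exact ⟨z, hz, (PathIn.of_adj hbΛ hb'z.left_mem hbadj).trans hb'z⟩

end Clusters

/-! ## Registered export -/

/-- **Entry data (registered helper signature of this file; = `Clusters.exists_entry` with explicit
binders).** -/
theorem locMod_clusters_main :
    ∀ (n : ℕ) (ω' : Set (Sym2 (Site 3))) (Q : Finset (Site 3)) (x₁ : Site 3),
      ω' ⊆ (zdGraph 3).edgeSet → x₁ ∈ Q → PathIn (openGraph ω') ↑(box 3 n) 0 x₁ →
      ∃ (a : Site 3) (Ga : Finset (Sym2 (Site 3))),
        a ∈ Q ∧ a ∈ box 3 n ∧ (↑Ga : Set (Sym2 (Site 3))) ⊆ ω' ∧ Ga ⊆ edgesTouching (zdGraph 3) Q ∧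
        PathIn (openGraph ω') ↑(box 3 n) 0 a ∧
        PathIn (openGraph ((ω' \ ↑(edgesTouching (zdGraph 3) Q)) ∪ ↑Ga)) ↑(box 3 n) 0 a ∧
        (∀ g ∈ Ga, ∀ y ∈ g,
          PathIn (openGraph (ω' \ ↑(edgesTouching (zdGraph 3) Q))) ↑(box 3 n) 0 y ∨ y = a) ∧
        (∀ y, PathIn (openGraph (ω' \ ↑(edgesTouching (zdGraph 3) Q))) ↑(box 3 n) 0 y → y ∈ Q → y = a) :=
  fun _ _ _ _ hω hx₁ hC => Clusters.exists_entry hω hx₁ hC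

end Summit.CriticalPhenomena.PercolationContinuityZ3.Cruxes.CriticalCurveRegular.Locmod

end
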